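import Summits.BirchSwinnertonDyer.BirchSwinnertonDyer.Theorems.KolyvaginDepthDoorMSymbolCert718b1OddCore0
import Summits.BirchSwinnertonDyer.BirchSwinnertonDyer.Theorems.KolyvaginDepthDoorMSymbolCert718b1OddCore1
import Summits.BirchSwinnertonDyer.BirchSwinnertonDyer.Theorems.KolyvaginDepthDoorMSymbolCert718b1OddInv0
import Summits.BirchSwinnertonDyer.BirchSwinnertonDyer.Theorems.KolyvaginDepthDoorMSymbolCert718b1OddInv1
import HarnessLib

/-!
# Route `KolyvaginDepthDoor`, crux `KolyvaginDepthSupplyKN` (stmt-BirchSwinnertonDyer-22820) —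
# DEPTH TABLE v29, DATA (odd) of `718b1`, part 3: the pool part, the check, and the minus symbols of the newform of `718b1`

Helper file of the lead prover of line `levelone` (kdd-p1 g34; `--supports stmt-BirchSwinnertonDyer-22820 --as helper`);
MACHINE-WRITTEN DATA + `decide` (generator `work/py/gen5twistlean.py`, tools of TOOLS-v28). `certOdd718b1_check`, `poolOdd_holds` (`relImC_*`), `exists_line_odd_718b1`, `exists_ratMinusSymbol_eq_718b1` (`[a/n]⁻_{D.f} = ε S⁻(a/n)/(2g)`, `S⁻ = chainSumC 2 359 phim718b1`, kit 5′ `exists_ratMinusSymbol_eqC`). It closes nothing and BSD is NOT proved by it.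

References: [CremonaAlgorithms1997] §2.2–2.5, §2.8, Table 1 (718b1); [PopaZagier2017] §4 (13); [Kim2022StructureSelmer] §1.4.3;
[MazurTateTeitelbaum1986Invent] §I.8.
-/

set_option linter.dupNamespace false
-- the packed numerals are long literals
set_option linter.style.longLine false

noncomputable section

open scoped MatrixGroups ModularForm
open CongruenceSubgroup
open Literature.NumberTheory.EllipticCurves Literature.NumberTheory.EllipticCurves.ModularForms
open Literature.NumberTheory.Automorphic.PopaZagier (coeff12 coeff12M coeff coeffN)
open Summit.BirchSwinnertonDyer.BirchSwinnertonDyer.Rank2Observatory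
open Summit.BirchSwinnertonDyer.BirchSwinnertonDyer.Rank1Residual (IntModel.frobeniusTrace_eq IntModel.minimalDiscriminantInt_eq)
open Summit.BirchSwinnertonDyer.BirchSwinnertonDyer.Theorems.KolyvaginDepthDoor.MSymbolCert.Cert389a1
  (H3 H3fin support_subset_H3fin H3fin_det H3mat_nodup H3_det H3_coeff eval_map eval_append)

namespace Summit.BirchSwinnertonDyer.BirchSwinnertonDyer.Theorems.KolyvaginDepthDoor.MSymbolCert.Cert718b1

/-! ## §1 Part 3 of the check; the check -/

set_option maxHeartbeats 4000000 in
/-- **Certificate part 3 and the check**: `φ⁻` satisfies the pool (chunked kernel checks) — with parts 1, 2a, 2b the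
certificate checks (kits 2c–2e `checkF_of_parts`). [folklore] -/
theorem certOdd718b1_check : certOdd718b1.checkF genOdd718b1 5400 1080 phim718b1 = true := by
  have hq0 : (List.range' 0 750).all (fun k => evalInt phim718b1 (genOdd718b1 k) == 0) = true := by decide +kernel
  have hq1 : (List.range' 750 750).all (fun k => evalInt phim718b1 (genOdd718b1 k) == 0) = true := by decide +kernel
  have hq2 : (List.range' 1500 750).all (fun k => evalInt phim718b1 (genOdd718b1 k) == 0) = true := by decide +kernel
  have hq3 : (List.range' 2250 750).all (fun k => evalInt phim718b1 (genOdd718b1 k) == 0) = true := by decide +kernel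
  have hq4 : (List.range' 3000 750).all (fun k => evalInt phim718b1 (genOdd718b1 k) == 0) = true := by decide +kernel
  have hq5 : (List.range' 3750 750).all (fun k => evalInt phim718b1 (genOdd718b1 k) == 0) = true := by decide +kernel
  have hq6 : (List.range' 4500 750).all (fun k => evalInt phim718b1 (genOdd718b1 k) == 0) = true := by decide +kernel
  have hq7 : (List.range' 5250 150).all (fun k => evalInt phim718b1 (genOdd718b1 k) == 0) = true := by decide +kernel
  have hpool : certOdd718b1.partPool genOdd718b1 5400 phim718b1 = true :=
    certOdd718b1.partPool_of_forall _ _ _ (fun k hk => by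
      by_cases c0 : k < 750
      · exact evalInt_chunk hq0 k (by omega) (by omega)
      by_cases c1 : k < 1500
      · exact evalInt_chunk hq1 k (by omega) (by omega)
      by_cases c2 : k < 2250
      · exact evalInt_chunk hq2 k (by omega) (by omega)
      by_cases c3 : k < 3000
      · exact evalInt_chunk hq3 k (by omega) (by omega)
      by_cases c4 : k < 3750
      · exact evalInt_chunk hq4 k (by omega) (by omega)
      by_cases c5 : k < 4500
      · exact evalInt_chunk hq5 k (by omega) (by omega)
      by_cases c6 : k < 5250
      · exact evalInt_chunk hq6 k (by omega) (by omega)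
      exact evalInt_chunk hq7 k (by omega) (by omega)) (by decide +kernel)
  have hcore : certOdd718b1.partCore genOdd718b1 = true :=
    certOdd718b1.partCore_of_forall _ (fun k hk => by
      have hm1 : certOdd718b1.m - 1 = 92 := rfl
      by_cases c0 : k < 46
      · exact certOdd718b1_coreRows0 k (by omega) c0
      exact certOdd718b1_coreRows1 k (by omega) (by omega))
  have hinv : certOdd718b1.partInv = true :=
    certOdd718b1.partInv_of_forall (fun k hk => by
      have hm1 : certOdd718b1.m - 1 = 92 := rfl
      by_cases c0 : k < 46
      · exact certOdd718b1_invRows0 k (by omega) c0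
      exact certOdd718b1_invRows1 k (by omega) (by omega))
  exact certOdd718b1.checkF_of_parts _ _ _ _ certOdd718b1_partPeel hcore hinv hpool

/-! ## §2 The odd pool holds -/

/-- **The odd pool holds** for `f ∈ S₂(Γ₀(718))` with real Fourier coefficients, `a₃ = -2`, `a₅ = -3` (kit 1′:
`relImC_two/three/iota/hecke` over pair indices). [cite: CremonaAlgorithms1997, §2.2–2.5] [cite: PopaZagier2017, §4 (13)] -/
theorem poolOdd_holds (f : CuspForm (Gamma0 (2 * 359)) 2) (hreal : ∀ m, (cuspCoeff f m).im = 0)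
    (hT : heckeTnGamma0 (2 * 359) 2 3 f = ((-2 : ℝ) : ℂ) • f)
    (hT5 : heckeTnGamma0 (2 * 359) 2 5 f = ((-3 : ℝ) : ℂ) • f) (k : ℕ) : eval (ΨmC f) (genOdd718b1 k) = 0 := by
  set i := k / 5 with hi
  have hcases : k % 5 = 0 ∨ k % 5 = 1 ∨ k % 5 = 2 ∨ k % 5 = 3 ∨ 4 ≤ k % 5 := by omega
  rcases hcases with h | h | h | h | h
  · rw [genOdd718b1, if_pos h]
    have := relImC_two f i
    simp only [eval, Int.cast_one, one_mul, add_zero]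
    linarith
  · rw [genOdd718b1, if_neg (by omega), if_pos h]
    have := relImC_iota f hreal i
    simp only [eval, Int.cast_one, one_mul, add_zero]
    linarith
  · rw [genOdd718b1, if_neg (by omega), if_neg (by omega), if_pos h]
    have := relImC_three f i
    simp only [eval, Int.cast_one, one_mul, add_zero]
    linarith
  · rw [genOdd718b1, if_neg (by omega), if_neg (by omega), if_neg (by omega), if_pos h, eval_append, eval_map]
    have hH := relImC_hecke f (n := 3) (by norm_num) (by norm_num) hT H3fin support_subset_H3fin H3fin_det i
    rw [H3fin, List.sum_toFinset _ H3mat_nodup, List.map_map, List.map_map] at hH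
    simp only [Function.comp_def, Nat.cast_ofNat] at hH
    have hterm : ∀ t ∈ H3, (coeffN 3 (toMat t.1) : ℝ) * ΨmC f (actIdxC 2 359 (toMat t.1) i) =
        (1 / 12 : ℝ) * ((t.2 : ℝ) * ΨmC f (actCN 2 359 t.1 i)) := by
      intro t ht
      rw [actCN_eq]
      have hcN : coeffN 3 (toMat t.1) = (t.2 : ℚ) / 12 := by
        have hd : (toMat t.1).det = 3 := by rw [toMat, Matrix.det_fin_two_of]; exact H3_det t ht
        unfold coeffN coeff coeff12M
        rw [if_pos hd, ← H3_coeff t ht]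
        simp [toMat]
      rw [hcN]
      push_cast
      ring
    rw [List.map_congr_left hterm, List.sum_map_mul_left] at hH
    simp only [eval, Int.cast_ofNat, add_zero]
    linarith
  · rw [genOdd718b1, if_neg (by omega), if_neg (by omega), if_neg (by omega), if_neg (by omega), eval_append, eval_map]
    have hH := relImC_hecke f (n := 5) (by norm_num) (by norm_num) hT5 H5fin support_subset_H5fin H5fin_det i
    rw [H5fin, List.sum_toFinset _ H5mat_nodup, List.map_map, List.map_map] at hH
    simp only [Function.comp_def, Nat.cast_ofNat] at hH
    have hterm : ∀ t ∈ H5, (coeffN 5 (toMat t.1) : ℝ) * ΨmC f (actIdxC 2 359 (toMat t.1) i) =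
        (1 / 12 : ℝ) * ((t.2 : ℝ) * ΨmC f (actCN 2 359 t.1 i)) := by
      intro t ht
      rw [actCN_eq]
      have hcN : coeffN 5 (toMat t.1) = (t.2 : ℚ) / 12 := by
        have hd : (toMat t.1).det = 5 := by rw [toMat, Matrix.det_fin_two_of]; exact H5_det t ht
        unfold coeffN coeff coeff12M
        rw [if_pos hd, ← H5_coeff t ht]
        simp [toMat]
      rw [hcN]
      push_cast
      ring
    rw [List.map_congr_left hterm, List.sum_map_mul_left] at hH
    simp only [eval, Int.cast_ofNat, add_zero]
    linarith

/-! ## §3 The minus symbols of the newform of `718b1` -/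

/-- **`im [eC i]_{D.f} = t · φ⁻(i)`** for every parametrisation datum `D` of `718b1` at level `2·359`. [cite: CremonaAlgorithms1997, §2.5] -/
theorem exists_line_odd_718b1 (N : ℕ) (hN : N = 2 * 359) [NeZero N]
    (D : haveI := isElliptic_c718b1; ModularParametrizationData (((⟨1, 0, 1, -5, 0⟩ : WeierstrassCurve ℤ).map (Int.castRingHom ℚ))) N) :
    ∃ t : ℝ, ∀ i < (2 + 1) * (359 + 1), ΨmC (hN ▸ D.f) i = t * phim718b1 i := by
  have hT3 := heckeT3_718b1 N hN D
  have hT5 := heckeT5_718b1 N hN D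
  subst hN
  haveI := isElliptic_c718b1
  have hf := D.isNewformOf
  have hreal : ∀ m, (cuspCoeff D.f m).im = 0 := cuspCoeff_im_eq_zero_of_coeffField_eq_bot hf.coeffField_eq_bot
  have hF : ∀ k < 5400, eval (ΨmC D.f) (genOdd718b1 k) = 0 := fun k _ => poolOdd_holds D.f hreal hT3 hT5 k
  obtain ⟨t, ht⟩ := exists_eq_smul_of_checkF certOdd718b1 genOdd718b1 5400 1080 phim718b1 certOdd718b1_check (ΨmC D.f) hF
  exact ⟨t, fun i hi => ht i (by norm_num at hi; omega)⟩

/-- **`[a/n]⁻_{D.f} = ε · S⁻(a/n)/(2g)`** for every parametrisation datum `D` of `718b1` at level `2·359`, ONE `(g, ε)`,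
`S⁻ = chainSumC 2 359 phim718b1` (kit 5′). [cite: MazurTateTeitelbaum1986Invent, §I.8] -/
theorem exists_ratMinusSymbol_eq_718b1
    (D : haveI := isElliptic_c718b1; ModularParametrizationData (((⟨1, 0, 1, -5, 0⟩ : WeierstrassCurve ℤ).map (Int.castRingHom ℚ))) (2 * 359)) :
    ∃ (g : ℕ) (ε : ℤ), 0 < g ∧ (ε = 1 ∨ ε = -1) ∧
      ∀ (a w : ℤ) (n : ℕ), 0 < n → a * w % n = 1 → ∀ fuel : ℕ, n < fuel →
        ratMinusSymbol D.f ((a : ℚ) / n) = ε * chainSumC 2 359 phim718b1 fuel n w / (2 * g) := by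
  haveI := isElliptic_c718b1
  obtain ⟨t, ht⟩ := exists_line_odd_718b1 (2 * 359) rfl D
  exact exists_ratMinusSymbol_eqC D.f D.isNewformOf.1 D.isNewformOf.coeffField_eq_bot ht


end Summit.BirchSwinnertonDyer.BirchSwinnertonDyer.Theorems.KolyvaginDepthDoor.MSymbolCert.Cert718b1

end
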